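import Literature.MathematicalPhysics.QuantumManyBody.SwapEntropy
import Literature.MathematicalPhysics.QuantumManyBody.GroundState
import HarnessLib

/-!
# `GroundStateAccessible`, hard-core branch: support + density bound ⇒ accessible swap mass ≥ 1/2

Helper for item `GroundStateAccessible` (stmt-AtomisticToContinuum-12069) of route `BECInsertionVariance`
(`Summit.AtomisticToContinuum.BoseEinsteinCondensation.Theses.BECInsertionVariance.GroundStateAccessible`).
For UNBOUNDED admissible pair potentials (hard cores, hard shells, non-integrable cores) the nonnegative
ground state `Ψ₀` vanishes on part of the box, and the accessible swap mass `P_p(q ≠ 0)`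
(`p = Ψ₀² ⊗ Ψ₀²`, `q = p ∘ T`, `T` the exchange of particle `0` between two replicas) is `≥ 1/2` as soon
as two SEPARATE properties of `Ψ₀` hold, which this file isolates as Lean statements and glues
(kernel-checked bookkeeping, no analysis):

* SUPPORT (`hsupp`, irreducibility-type): for `p`-a.e. pair of configurations `(X, Y)`, if the
  teleported particles land farther than the range `R` from every particle of the receiving replica
  (`(X, Y) ∉ crossClose R`), then both swapped configurations are still in the support of `Ψ₀`
  (`q ≠ 0`). For hard spheres this is "the support of `Ψ₀` is the whole dilute component and inserting a
  non-overlapping sphere stays in it"; it is the content of `stub_uniqueUnbounded` of crux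
  `GroundStateRigidity` (stmt-AtomisticToContinuum-9072) seen from the swap picture.
* DENSITY (`hdens`): the `p`-probability that a teleported particle lands within `R` of some particle
  of the other replica is `≤ 1/2` — a one-body density bound for `Ψ₀`, uniform in `N` along the
  thermodynamic sequence (`≤ 2|B_R| ‖ρ⁽¹⁾‖₂²/N ≈ 2|B_R|ρ` at density `ρ`).

`half_le_swapMass_of_support_of_density`: SUPPORT ∧ DENSITY ⇒ `1/2 ≤ swapMass n Ψ₀` (for any
normalised measurable `Ψ₀`); `hardBranch_of_support_of_density`: the eventual forms along
`L = ((n+1)/ρ)^{1/3}` give the hard-core branch (H) of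
`groundStateAccessible_of_unique_of_unbounded` (`…GroundStateAccessibleReduction.lean`).
-/

noncomputable section

open MeasureTheory Filter Set
open scoped ENNReal NNReal Topology

namespace Summit.AtomisticToContinuum.BoseEinsteinCondensation.Theorems.BECInsertionVariance

open Literature.MathematicalPhysics.QuantumManyBody.BoseGas

variable {n : ℕ}

/-- The **cross-closeness event** of the two-replica picture at range `R`: the particle `0` of one
replica lies within distance `R` of some OTHER particle (`j ≠ 0`) of the other replica — exactly the
pairs `(X, Y)` for which teleporting `x₀ ↔ y₀` can create a new pair within the range of the
interaction. Written as a set (no auxiliary definition is load-bearing: the statements below inline it).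
[folklore] -/
theorem measurableSet_crossClose (R : ℝ) :
    MeasurableSet {Z : Config (n + 1) × Config (n + 1) |
      ∃ j : Fin (n + 1), j ≠ 0 ∧ (dist (Z.2 0) (Z.1 j) ≤ R ∨ dist (Z.1 0) (Z.2 j) ≤ R)} := by
  have h : {Z : Config (n + 1) × Config (n + 1) |
      ∃ j : Fin (n + 1), j ≠ 0 ∧ (dist (Z.2 0) (Z.1 j) ≤ R ∨ dist (Z.1 0) (Z.2 j) ≤ R)} =
      ⋃ j ∈ ({j : Fin (n + 1) | j ≠ 0} : Set (Fin (n + 1))),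
        ({Z | dist (Z.2 0) (Z.1 j) ≤ R} ∪ {Z | dist (Z.1 0) (Z.2 j) ≤ R}) := by
    ext Z
    simp only [mem_setOf_eq, mem_iUnion, mem_union, exists_prop]
  rw [h]
  refine MeasurableSet.biUnion (Set.to_countable _) fun j _ => MeasurableSet.union ?_ ?_
  · exact measurableSet_le (by fun_prop) measurable_const
  · exact measurableSet_le (by fun_prop) measurable_const

/-- **Support + density bound ⇒ accessible swap mass `≥ 1/2`.** Let `Φ` be a measurable real wave
function of `n + 1` particles with `∫ Φ² = 1`, and `R` a length. If
(SUPPORT) for a.e. pair `(X, Y)` with `p = Φ(X)²Φ(Y)² ≠ 0` that is not cross-close at range `R` the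
swapped density `q` is nonzero, and
(DENSITY) the `p`-mass of the cross-close pairs is `≤ 1/2`,
then `1/2 ≤ swapMass n Φ`. [folklore] -/
theorem half_le_swapMass_of_support_of_density {Φ : Config (n + 1) → ℝ} (hΦ : Measurable Φ)
    (h1 : ∫⁻ X, ENNReal.ofReal (Φ X ^ 2) = 1) (R : ℝ)
    (hsupp : ∀ᵐ Z : Config (n + 1) × Config (n + 1), replicaDensity Φ Z ≠ 0 →
      Z ∉ {Z : Config (n + 1) × Config (n + 1) |
        ∃ j : Fin (n + 1), j ≠ 0 ∧ (dist (Z.2 0) (Z.1 j) ≤ R ∨ dist (Z.1 0) (Z.2 j) ≤ R)} →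
      swappedDensity Φ Z ≠ 0)
    (hdens : ∫⁻ Z in {Z : Config (n + 1) × Config (n + 1) |
        ∃ j : Fin (n + 1), j ≠ 0 ∧ (dist (Z.2 0) (Z.1 j) ≤ R ∨ dist (Z.1 0) (Z.2 j) ≤ R)},
        ENNReal.ofReal (replicaDensity Φ Z) ≤ 1 / 2) :
    1 / 2 ≤ swapMass n Φ := by
  set E : Set (Config (n + 1) × Config (n + 1)) := {Z |
    ∃ j : Fin (n + 1), j ≠ 0 ∧ (dist (Z.2 0) (Z.1 j) ≤ R ∨ dist (Z.1 0) (Z.2 j) ≤ R)} with hEdef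
  have hE : MeasurableSet E := measurableSet_crossClose R
  set f : Config (n + 1) × Config (n + 1) → ℝ≥0∞ := fun Z => ENNReal.ofReal (replicaDensity Φ Z)
    with hfdef
  have hfm : Measurable f := (measurable_replicaDensity hΦ).ennreal_ofReal
  -- total mass `1`
  have htot : ∫⁻ Z, f Z = 1 := by
    rw [hfdef, lintegral_replicaDensity hΦ, h1, one_pow]
  -- split along `E`
  have hsplit : ∫⁻ Z, f Z = (∫⁻ Z in E, f Z) + ∫⁻ Z in Eᶜ, f Z :=
    (lintegral_add_compl (μ := volume) f hE).symm
  -- off `E`, the mass is accessible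
  have hacc : ∫⁻ Z in Eᶜ, f Z ≤ swapMass n Φ := by
    rw [swapMass, ← lintegral_indicator hE.compl,
      ← lintegral_indicator (measurableSet_swappedDensity_ne_zero hΦ)]
    refine lintegral_mono_ae ?_
    filter_upwards [hsupp] with Z hZ
    by_cases hZE : Z ∈ Eᶜ
    · rw [indicator_of_mem hZE]
      by_cases hp : replicaDensity Φ Z = 0
      · simp [hfdef, hp]
      · rw [indicator_of_mem (show Z ∈ {Z | swappedDensity Φ Z ≠ 0} from hZ hp hZE)]
    · rw [indicator_of_notMem hZE]
      exact bot_le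
  -- conclude: `1 ≤ 1/2 + swapMass`
  have hle : (1 : ℝ≥0∞) ≤ 1 / 2 + swapMass n Φ := by
    calc (1 : ℝ≥0∞) = (∫⁻ Z in E, f Z) + ∫⁻ Z in Eᶜ, f Z := by rw [← hsplit, htot]
      _ ≤ 1 / 2 + swapMass n Φ := add_le_add hdens hacc
  calc (1 / 2 : ℝ≥0∞) = 1 - 1 / 2 := by norm_num [ENNReal.sub_half]
    _ ≤ swapMass n Φ := tsub_le_iff_left.2 hle

/-- **The hard-core branch (H) from eventual SUPPORT and DENSITY statements about `groundState`.**
For every unbounded repulsive finite-range `v` and every range `R` of `v`: if along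
`L = ((n+1)/ρ)^{1/3}`, for small `ρ` and all large `n`, the nonnegative ground state
`Ψ₀ = groundState v (n+1) L` satisfies the support property and the cross-closeness `p`-mass is
`≤ 1/2`, then its accessible swap mass is eventually `≥ 1/2` — the hypothesis (H) of
`groundStateAccessible_of_unique_of_unbounded`. (Existence/normalisation of `Ψ₀` is part of the
hypotheses' eventual sets via `∫ Ψ₀² = 1`, available from `eventually_isGroundState_groundState`.)
[folklore] -/
theorem hardBranch_of_support_of_density
    (hSD : ∀ v : ℝ → ℝ≥0∞, IsRepulsiveFiniteRange v → (¬ ∃ C : ℝ≥0, ∀ r, v r ≤ C) →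
      ∃ (R ρ₀ : ℝ), 0 < ρ₀ ∧ ∀ ρ : ℝ, 0 < ρ → ρ < ρ₀ → ∀ᶠ n : ℕ in atTop,
        (∫⁻ X, ENNReal.ofReal (groundState v (n + 1) (sideLength ρ (n + 1)) X ^ 2) = 1) ∧
        (∀ᵐ Z : Config (n + 1) × Config (n + 1),
          replicaDensity (groundState v (n + 1) (sideLength ρ (n + 1))) Z ≠ 0 →
          Z ∉ {Z : Config (n + 1) × Config (n + 1) |
            ∃ j : Fin (n + 1), j ≠ 0 ∧ (dist (Z.2 0) (Z.1 j) ≤ R ∨ dist (Z.1 0) (Z.2 j) ≤ R)} →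
          swappedDensity (groundState v (n + 1) (sideLength ρ (n + 1))) Z ≠ 0) ∧
        (∫⁻ Z in {Z : Config (n + 1) × Config (n + 1) |
            ∃ j : Fin (n + 1), j ≠ 0 ∧ (dist (Z.2 0) (Z.1 j) ≤ R ∨ dist (Z.1 0) (Z.2 j) ≤ R)},
          ENNReal.ofReal (replicaDensity (groundState v (n + 1) (sideLength ρ (n + 1))) Z) ≤ 1 / 2)) :
    ∀ v : ℝ → ℝ≥0∞, IsRepulsiveFiniteRange v → (¬ ∃ C : ℝ≥0, ∀ r, v r ≤ C) →
      ∃ ρ₀ : ℝ, 0 < ρ₀ ∧ ∀ ρ : ℝ, 0 < ρ → ρ < ρ₀ → ∀ᶠ n : ℕ in atTop,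
        (1 / 2 : ℝ≥0∞) ≤ swapMass n (groundState v (n + 1) (sideLength ρ (n + 1))) := by
  intro v hv hb
  obtain ⟨R, ρ₀, hρ₀, h⟩ := hSD v hv hb
  refine ⟨ρ₀, hρ₀, fun ρ hρ hρ' => ?_⟩
  filter_upwards [h ρ hρ hρ'] with n hn
  obtain ⟨h1, hsupp, hdens⟩ := hn
  exact half_le_swapMass_of_support_of_density (measurable_groundState v (n + 1) _) h1 R hsupp hdens

end Summit.AtomisticToContinuum.BoseEinsteinCondensation.Theorems.BECInsertionVariance

end
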